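import Literature.NumberTheory.PAdicHodge.WeilPairingPeriodExtension
import HarnessLib

/-!
# The Weil pairing as a `B`-bilinear form `E_B : (B ⊗ V_pW) × (B ⊗ V_pW) → B` along the period line

Topic `Literature/NumberTheory/PAdicHodge`. Sequel of `WeilPairingPeriodExtension` (the half-extended pairing
`⟨·,·⟩~ = weilPeriodPairing : T_pW × (B ⊗ V_pW) → B`, `⟨S, b ⊗ (c ⊗ T)⟩~ = b·c·ι_B(e_∞(S,T))`). Kato's computation in the proof of
LNM 1553 II Lemma 1.4.3 manipulates the FULLY extended pairing `e_B : (B_dR ⊗ V) × (B_dR ⊗ V) → B_dR` (`B`-bilinear, `Γ_F`-equivariant):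
after `1 ⊗ η(σ) = σ y − y + log χ(σ) · β` (dual-exponential resolution, tree `PeriodRingData.IsDualExpOf`) and `1 ⊗ κ_P(τ) = τ ỹ − ỹ`
(brick K1) one expands `ι((η ∪ κ_P)(σ, τ)) = E_B(1 ⊗ η σ, σ(1 ⊗ κ_P τ))` by bilinearity. This file constructs `E_B` for any period-ring
datum `𝔅` receiving `B_dR⁺` (`j`, `hjq`, `hj` as in `WeilPairingPeriodExtension`):

* §1 ★ `weilPairingPadicHom_smul_left` (`e_∞(a • S, T) = e_∞(S, T)^a`), ★ `weilPeriodPairing_smul_left` (`⟨a • S, y⟩~ = a · ⟨S, y⟩~`),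
  `weilPeriodPairing_smul_right'` (`⟨S, b • y⟩~ = b · ⟨S, y⟩~` for `b ∈ B`);
* §2 ★ `weilPeriodForm W 𝔅 j e … hjq : (𝔅.B ⊗ V_pW) →+ (𝔅.B ⊗ V_pW) →+ 𝔅.B` with **`E_B(b ⊗ (c ⊗ S), y) = b · c · ⟨S, y⟩~`**
  (`weilPeriodForm_tmul`; two balanced `TensorProduct.liftAddHom`s), ★ `weilPeriodForm_toAmbient` (`E_B(1 ⊗ 1 ⊗ S, y) = ⟨S, y⟩~`),
  `weilPeriodForm_toAmbient_toAmbient` (`E_B(1⊗1⊗S, 1⊗1⊗T) = ι_B(e_∞(S, T))`), ★ `weilPeriodForm_smul_left` / `weilPeriodForm_smul_right`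
  (**`B`-bilinearity**: `E_B(b • y, y') = b · E_B(y, y') = E_B(y, b • y')`), ★★ `smul_weilPeriodForm` (**equivariance**
  `σ • E_B(y, y') = E_B(σ y, σ y')` for the diagonal `PeriodRingData.tensorRep`).

Definitions (reviewed): `weilPeriodForm` (+ two private stages). No named fact, no instance, no `sorry`. Line `kato_lever` of crux K★
`stmt-BirchSwinnertonDyer-22226` ((H4) computation socket); BSD / K★ / [REC] are NOT proved by any of this.

## References
* K. Kato, LNM 1553 (1993), Ch. II §1.2.4 (`e_B`), proof of Lemma 1.4.3. [Kato1993LNM1553]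
* J. H. Silverman, *AEC* (2009), Prop. III.8.1 (bilinearity of the Weil pairing). [SilvermanAEC2009]
* J.-M. Fontaine, Astérisque 223 (1994), Exp. III §1.5. [FontaineAsterisque223III]
-/

noncomputable section

open Field Function ValuativeRel WittVector
open scoped TensorProduct

namespace Literature.NumberTheory.PAdicHodge

open Literature.NumberTheory.GaloisRepresentations
open Literature.NumberTheory.GaloisRepresentations.IsNonarchimedeanLocalField
open Literature.NumberTheory.GaloisCohomology
open Literature.NumberTheory.EllipticCurves
open _root_.WeierstrassCurve

universe w

variable {F : Type} [Field F] {p : ℕ} [Fact p.Prime] {K₀ : Type} [Field K₀] (W : WeierstrassCurve K₀)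

omit [Fact p.Prime] in
/-- An additive map out of the synonym `V_pW = ℚ_p ⊗_{ℤ_p} T_pW` is determined on pure tensors. [folklore] -/
private theorem addMonoidHom_rational_ext' [Fact p.Prime] {X : Type*} [AddCommGroup X] {f g : W.rationalTateModule p →+ X}
    (h : ∀ (c : ℚ_[p]) (T : W.tateModule p), f (c ⊗ₜ[ℤ_[p]] T) = g (c ⊗ₜ[ℤ_[p]] T)) : f = g :=
  AddMonoidHom.ext fun v => TensorProduct.induction_on (motive := fun v => f v = g v) v
    ((map_zero f).trans (map_zero g).symm) (fun c T => h c T)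
    (fun x y hx hy => (map_add f x y).trans (((congrArg₂ (· + ·) hx hy)).trans (map_add g x y).symm))

/-! ## §1 Linearity of `e_∞` and of `⟨·,·⟩~` in the first variable -/

section Left

variable [Algebra K₀ F]
  (e : (k : ℕ) → geomTorsion W ((p ^ k : ℕ) : ℤ) → geomTorsion W ((p ^ k : ℕ) : ℤ) → AlgebraicClosure K₀)
  (hμ : ∀ k S T, e k S T ^ (p ^ k) = 1) (hadd₁ : ∀ k S₁ S₂ T, e k (S₁ + S₂) T = e k S₁ T * e k S₂ T)
  (hadd₂ : ∀ k S T₁ T₂, e k S (T₁ + T₂) = e k S T₁ * e k S T₂)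
  (hcompat : ∀ k (S T : geomTorsion W ((p ^ (k + 1) : ℕ) : ℤ)),
    e k (torsionMulHom W (p ^ (k + 1)) (p ^ k) p (pow_succ p k).symm S)
      (torsionMulHom W (p ^ (k + 1)) (p ^ k) p (pow_succ p k).symm T) = e (k + 1) S T ^ p)

/-- ★ **`e_∞(a • S, T) = e_∞(S, T)^a`** for `a ∈ ℤ_p` (levelwise additivity in the first variable).
[cite: SilvermanAEC2009, Prop. III.8.1 (a)] [cite: Kato1993LNM1553, Ch. II 1.4.2] -/
theorem weilPairingPadicHom_smul_left (S T : W.tateModule p) (a : ℤ_[p]) :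
    weilPairingPadicHom W F p e hμ hadd₁ hadd₂ hcompat (a • S) T =
      twistHom F p (weilPairingPadicHom W F p e hμ hadd₁ hadd₂ hcompat S T) a := by
  refine Subtype.ext (funext fun k => ?_)
  rw [coe_weilPairingPadicHom, coe_twistHom, twistCoord_eq_zsmul, coe_weilPairingPadicHom, weilPairingPadicCoord,
    weilPairingPadicCoord, tateProjHom_padicInt_smul, map_nsmul, AddMonoidHom.nsmul_apply, map_nsmul, natCast_zsmul]

end Left

variable [ValuativeRel F] [TopologicalSpace F] [IsNonarchimedeanLocalField F] [CharZero F] [Fact (¬ IsUnit (p : integerC F))]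
  [IsAdicComplete (Ideal.span {(p : integerC F)}) (integerC F)] [Algebra ℚ_[p] F]
  (𝔅 : PeriodRingData.{0, 0, 0, w} (absoluteGaloisGroup F) ℚ_[p] F) (j : BDeRhamPlus (integerC F) p →+* 𝔅.B)
  [Algebra K₀ F]
  (e : (k : ℕ) → geomTorsion W ((p ^ k : ℕ) : ℤ) → geomTorsion W ((p ^ k : ℕ) : ℤ) → AlgebraicClosure K₀)
  (hμ : ∀ k S T, e k S T ^ (p ^ k) = 1) (hadd₁ : ∀ k S₁ S₂ T, e k (S₁ + S₂) T = e k S₁ T * e k S₂ T)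
  (hadd₂ : ∀ k S T₁ T₂, e k S (T₁ + T₂) = e k S T₁ * e k S T₂)
  (hgal : ∀ k (σ : absoluteGaloisGroup K₀) (S T : geomTorsion W ((p ^ k : ℕ) : ℤ)), σ • e k S T = e k (σ • S) (σ • T))
  (hcompat : ∀ k (S T : geomTorsion W ((p ^ (k + 1) : ℕ) : ℤ)),
    e k (torsionMulHom W (p ^ (k + 1)) (p ^ k) p (pow_succ p k).symm S)
      (torsionMulHom W (p ^ (k + 1)) (p ^ k) p (pow_succ p k).symm T) = e (k + 1) S T ^ p)
  (hjq : ∀ c : ℚ_[p], j (qpToBdR c) = algebraMap ℚ_[p] 𝔅.B c)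

/-- ★ **`⟨a • S, y⟩~ = a · ⟨S, y⟩~`** (`a ∈ ℤ_p`; from `e_∞(a • S, T) = e_∞(S,T)^a` and `ι_B(ζ^a) = a · ι_B(ζ)`).
[cite: Kato1993LNM1553, Ch. II, proof of Lemma 1.4.3] -/
theorem weilPeriodPairing_smul_left (a : ℤ_[p]) (S : W.tateModule p) (y : 𝔅.B ⊗[ℚ_[p]] W.rationalTateModule p) :
    weilPeriodPairing W 𝔅 j e hμ hadd₁ hadd₂ hcompat hjq (a • S) y =
      algebraMap ℚ_[p] 𝔅.B (a : ℚ_[p]) * weilPeriodPairing W 𝔅 j e hμ hadd₁ hadd₂ hcompat hjq S y := by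
  have h1 := addMonoidHom_rational_ext' W
    (f := (weilPeriodPairing W 𝔅 j e hμ hadd₁ hadd₂ hcompat hjq (a • S)).comp
      (TensorProduct.mk ℚ_[p] 𝔅.B (W.rationalTateModule p) 1).toAddMonoidHom)
    (g := (AddMonoidHom.mulLeft (algebraMap ℚ_[p] 𝔅.B (a : ℚ_[p]))).comp
      ((weilPeriodPairing W 𝔅 j e hμ hadd₁ hadd₂ hcompat hjq S).comp
        (TensorProduct.mk ℚ_[p] 𝔅.B (W.rationalTateModule p) 1).toAddMonoidHom))
    fun c T => by
      change weilPeriodPairing W 𝔅 j e hμ hadd₁ hadd₂ hcompat hjq (a • S) ((1 : 𝔅.B) ⊗ₜ[ℚ_[p]] (c ⊗ₜ[ℤ_[p]] T)) =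
        algebraMap ℚ_[p] 𝔅.B (a : ℚ_[p]) * weilPeriodPairing W 𝔅 j e hμ hadd₁ hadd₂ hcompat hjq S ((1 : 𝔅.B) ⊗ₜ[ℚ_[p]] (c ⊗ₜ[ℤ_[p]] T))
      rw [weilPeriodPairing_tmul, weilPeriodPairing_tmul, one_mul, one_mul, weilPairingPadicHom_smul_left, periodLineB_twistHom hjq]
      ring
  induction y using TensorProduct.induction_on with
  | zero => simp only [map_zero, mul_zero]
  | tmul b v =>
    have hv : weilPeriodPairing W 𝔅 j e hμ hadd₁ hadd₂ hcompat hjq (a • S) ((1 : 𝔅.B) ⊗ₜ[ℚ_[p]] v) =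
        algebraMap ℚ_[p] 𝔅.B (a : ℚ_[p]) * weilPeriodPairing W 𝔅 j e hμ hadd₁ hadd₂ hcompat hjq S ((1 : 𝔅.B) ⊗ₜ[ℚ_[p]] v) :=
      DFunLike.congr_fun h1 v
    rw [weilPeriodPairing_tmul_eq_mul, weilPeriodPairing_tmul_eq_mul W 𝔅 j e hμ hadd₁ hadd₂ hcompat hjq S, hv]
    ring
  | add x y hx hy => rw [map_add, map_add, hx, hy, mul_add]

/-- **`⟨S, b • y⟩~ = b · ⟨S, y⟩~`** for `b ∈ B` (`B`-linearity of the half-extended pairing in the ambient variable).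
[cite: Kato1993LNM1553, Ch. II, proof of Lemma 1.4.3] -/
theorem weilPeriodPairing_smul_right' (S : W.tateModule p) (b : 𝔅.B) (y : 𝔅.B ⊗[ℚ_[p]] W.rationalTateModule p) :
    weilPeriodPairing W 𝔅 j e hμ hadd₁ hadd₂ hcompat hjq S (b • y) = b * weilPeriodPairing W 𝔅 j e hμ hadd₁ hadd₂ hcompat hjq S y := by
  induction y using TensorProduct.induction_on with
  | zero => rw [smul_zero, map_zero, mul_zero]
  | tmul b' v =>
    rw [TensorProduct.smul_tmul', smul_eq_mul, weilPeriodPairing_tmul_eq_mul,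
      weilPeriodPairing_tmul_eq_mul W 𝔅 j e hμ hadd₁ hadd₂ hcompat hjq S b', mul_assoc]
  | add x y hx hy => rw [smul_add, map_add, map_add, hx, hy, mul_add]

/-! ## §2 The bilinear form `E_B` -/

/-- Stage 1: `(c, S) ↦ c · ⟨S, ·⟩~`, biadditive, with values in `Hom(B ⊗ V_pW, B)`. [cite: Kato1993LNM1553, Ch. II §1.2.4] -/
private def formStage₁ : ℚ_[p] →+ W.tateModule p →+ (𝔅.B ⊗[ℚ_[p]] W.rationalTateModule p →+ 𝔅.B) :=
  AddMonoidHom.mk' (fun c => AddMonoidHom.mk'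
      (fun S => (AddMonoidHom.mulLeft (algebraMap ℚ_[p] 𝔅.B c)).comp (weilPeriodPairing W 𝔅 j e hμ hadd₁ hadd₂ hcompat hjq S))
      fun S S' => AddMonoidHom.ext fun y => by
        simp only [AddMonoidHom.comp_apply, AddMonoidHom.coe_mulLeft, map_add, AddMonoidHom.add_apply])
    fun c c' => AddMonoidHom.ext fun S => AddMonoidHom.ext fun y => by
      simp only [AddMonoidHom.mk'_apply, AddMonoidHom.comp_apply, AddMonoidHom.coe_mulLeft, AddMonoidHom.add_apply, map_add, add_mul]

/-- Unfolding stage 1. [cite: Kato1993LNM1553, Ch. II §1.2.4] -/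
private theorem formStage₁_apply (c : ℚ_[p]) (S : W.tateModule p) (y : 𝔅.B ⊗[ℚ_[p]] W.rationalTateModule p) :
    formStage₁ W 𝔅 j e hμ hadd₁ hadd₂ hcompat hjq c S y =
      algebraMap ℚ_[p] 𝔅.B c * weilPeriodPairing W 𝔅 j e hμ hadd₁ hadd₂ hcompat hjq S y := rfl

/-- Stage 2: `V_pW →+ Hom(B ⊗ V_pW, B)`, `c ⊗ S ↦ c · ⟨S, ·⟩~` (`ℤ_p`-balanced by `weilPeriodPairing_smul_left`).
[cite: Kato1993LNM1553, Ch. II §1.2.4] -/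
private def formStage₂ : W.rationalTateModule p →+ (𝔅.B ⊗[ℚ_[p]] W.rationalTateModule p →+ 𝔅.B) :=
  TensorProduct.liftAddHom (formStage₁ W 𝔅 j e hμ hadd₁ hadd₂ hcompat hjq) fun a c S => AddMonoidHom.ext fun y => by
    rw [formStage₁_apply, formStage₁_apply, weilPeriodPairing_smul_left, Algebra.smul_def, PadicInt.algebraMap_apply, map_mul]
    ring

/-- Stage 2 on pure tensors. [cite: Kato1993LNM1553, Ch. II §1.2.4] -/
private theorem formStage₂_tmul (c : ℚ_[p]) (S : W.tateModule p) (y : 𝔅.B ⊗[ℚ_[p]] W.rationalTateModule p) :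
    formStage₂ W 𝔅 j e hμ hadd₁ hadd₂ hcompat hjq (c ⊗ₜ[ℤ_[p]] S) y =
      algebraMap ℚ_[p] 𝔅.B c * weilPeriodPairing W 𝔅 j e hμ hadd₁ hadd₂ hcompat hjq S y :=
  DFunLike.congr_fun (TensorProduct.liftAddHom_tmul (formStage₁ W 𝔅 j e hμ hadd₁ hadd₂ hcompat hjq) _ c S) y

/-- Stage 2 is `ℚ_p`-linear (as an identity of additive maps). [cite: Kato1993LNM1553, Ch. II §1.2.4] -/
private theorem formStage₂_smul (c : ℚ_[p]) (v : W.rationalTateModule p) (y : 𝔅.B ⊗[ℚ_[p]] W.rationalTateModule p) :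
    formStage₂ W 𝔅 j e hμ hadd₁ hadd₂ hcompat hjq (c • v) y = algebraMap ℚ_[p] 𝔅.B c * formStage₂ W 𝔅 j e hμ hadd₁ hadd₂ hcompat hjq v y := by
  have h := addMonoidHom_rational_ext' W
    (f := (AddMonoidHom.eval y).comp ((formStage₂ W 𝔅 j e hμ hadd₁ hadd₂ hcompat hjq).comp
      (DistribSMul.toAddMonoidHom (W.rationalTateModule p) c)))
    (g := (AddMonoidHom.mulLeft (algebraMap ℚ_[p] 𝔅.B c)).comp ((AddMonoidHom.eval y).comp
      (formStage₂ W 𝔅 j e hμ hadd₁ hadd₂ hcompat hjq)))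
    fun c' T => by
      change formStage₂ W 𝔅 j e hμ hadd₁ hadd₂ hcompat hjq (c • (c' ⊗ₜ[ℤ_[p]] T)) y =
        algebraMap ℚ_[p] 𝔅.B c * formStage₂ W 𝔅 j e hμ hadd₁ hadd₂ hcompat hjq (c' ⊗ₜ[ℤ_[p]] T) y
      rw [TensorProduct.smul_tmul', formStage₂_tmul, formStage₂_tmul, smul_eq_mul, map_mul, mul_assoc]
  exact DFunLike.congr_fun h v

/-- ★ **The `B`-bilinear form `E_B : (B ⊗_{ℚ_p} V_pW) × (B ⊗_{ℚ_p} V_pW) → B` extending the Weil pairing along the period line**: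
`E_B(b ⊗ (c ⊗ S), y) = b · c · ⟨S, y⟩~` (`ℚ_p`-balanced by `formStage₂_smul`). Kato's `e_B` of II §1.2.4 read through
`ℤ_p(1) → ℤ_p · t ⊆ B`. [cite: Kato1993LNM1553, Ch. II §1.2.4 and proof of Lemma 1.4.3] -/
def weilPeriodForm : 𝔅.B ⊗[ℚ_[p]] W.rationalTateModule p →+ (𝔅.B ⊗[ℚ_[p]] W.rationalTateModule p →+ 𝔅.B) :=
  TensorProduct.liftAddHom
    (AddMonoidHom.mk' (fun b => AddMonoidHom.mk'
        (fun v => (AddMonoidHom.mulLeft b).comp (formStage₂ W 𝔅 j e hμ hadd₁ hadd₂ hcompat hjq v))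
        fun v v' => AddMonoidHom.ext fun y => by
          simp only [AddMonoidHom.comp_apply, AddMonoidHom.coe_mulLeft, map_add, AddMonoidHom.add_apply])
      fun b b' => AddMonoidHom.ext fun v => AddMonoidHom.ext fun y => by
        simp only [AddMonoidHom.mk'_apply, AddMonoidHom.comp_apply, AddMonoidHom.coe_mulLeft, AddMonoidHom.add_apply, add_mul])
    fun c b v => AddMonoidHom.ext fun y => by
      change (c • b) * formStage₂ W 𝔅 j e hμ hadd₁ hadd₂ hcompat hjq v y = b * formStage₂ W 𝔅 j e hμ hadd₁ hadd₂ hcompat hjq (c • v) y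
      rw [formStage₂_smul, Algebra.smul_def]
      ring

/-- ★ **Values of `E_B` on pure tensors: `E_B(b ⊗ (c ⊗ S), y) = b · (c · ⟨S, y⟩~)`.** [cite: Kato1993LNM1553, Ch. II §1.2.4] -/
theorem weilPeriodForm_tmul (b : 𝔅.B) (c : ℚ_[p]) (S : W.tateModule p) (y : 𝔅.B ⊗[ℚ_[p]] W.rationalTateModule p) :
    weilPeriodForm W 𝔅 j e hμ hadd₁ hadd₂ hcompat hjq (b ⊗ₜ[ℚ_[p]] (c ⊗ₜ[ℤ_[p]] S : W.rationalTateModule p)) y =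
      b * (algebraMap ℚ_[p] 𝔅.B c * weilPeriodPairing W 𝔅 j e hμ hadd₁ hadd₂ hcompat hjq S y) := by
  rw [weilPeriodForm, TensorProduct.liftAddHom_tmul]
  change b * formStage₂ W 𝔅 j e hμ hadd₁ hadd₂ hcompat hjq (c ⊗ₜ[ℤ_[p]] S) y = _
  rw [formStage₂_tmul]

/-- `E_B(b ⊗ v, y) = b · E_B(1 ⊗ v, y)`. [cite: Kato1993LNM1553, Ch. II §1.2.4] -/
theorem weilPeriodForm_tmul_eq_mul (b : 𝔅.B) (v : W.rationalTateModule p) (y : 𝔅.B ⊗[ℚ_[p]] W.rationalTateModule p) :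
    weilPeriodForm W 𝔅 j e hμ hadd₁ hadd₂ hcompat hjq (b ⊗ₜ[ℚ_[p]] v) y =
      b * weilPeriodForm W 𝔅 j e hμ hadd₁ hadd₂ hcompat hjq ((1 : 𝔅.B) ⊗ₜ[ℚ_[p]] v) y := by
  rw [weilPeriodForm, TensorProduct.liftAddHom_tmul, TensorProduct.liftAddHom_tmul]
  change b * formStage₂ W 𝔅 j e hμ hadd₁ hadd₂ hcompat hjq v y = b * (1 * formStage₂ W 𝔅 j e hμ hadd₁ hadd₂ hcompat hjq v y)
  rw [one_mul]

/-- ★ **`E_B(1 ⊗ 1 ⊗ S, y) = ⟨S, y⟩~`**: `E_B` extends the half-extended pairing along `T_pW → B ⊗ V_pW`.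
[cite: Kato1993LNM1553, Ch. II §1.2.4] -/
theorem weilPeriodForm_toAmbient (S : W.tateModule p) (y : 𝔅.B ⊗[ℚ_[p]] W.rationalTateModule p) :
    weilPeriodForm W 𝔅 j e hμ hadd₁ hadd₂ hcompat hjq (toAmbient W 𝔅 S) y = weilPeriodPairing W 𝔅 j e hμ hadd₁ hadd₂ hcompat hjq S y := by
  rw [toAmbient_apply, TateModule.toRational_apply, weilPeriodForm_tmul, map_one, one_mul, one_mul]

/-- **`E_B(1 ⊗ 1 ⊗ S, 1 ⊗ 1 ⊗ T) = ι_B(e_∞(S, T))`**: on `T_pW × T_pW` the form IS the Weil pairing read through the period line.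
[cite: Kato1993LNM1553, Ch. II §1.2.4] -/
theorem weilPeriodForm_toAmbient_toAmbient (S T : W.tateModule p) :
    weilPeriodForm W 𝔅 j e hμ hadd₁ hadd₂ hcompat hjq (toAmbient W 𝔅 S) (toAmbient W 𝔅 T) =
      periodLineB 𝔅 j ((weilContPairingPadic W F p e hμ hadd₁ hadd₂ hgal hcompat).toLin S T) := by
  rw [weilPeriodForm_toAmbient, weilPeriodPairing_toAmbient W 𝔅 j e hμ hadd₁ hadd₂ hgal hcompat hjq]

/-- ★ **`B`-linearity on the left: `E_B(b • y, y') = b · E_B(y, y')`.** [cite: Kato1993LNM1553, Ch. II §1.2.4] -/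
theorem weilPeriodForm_smul_left (b : 𝔅.B) (y y' : 𝔅.B ⊗[ℚ_[p]] W.rationalTateModule p) :
    weilPeriodForm W 𝔅 j e hμ hadd₁ hadd₂ hcompat hjq (b • y) y' = b * weilPeriodForm W 𝔅 j e hμ hadd₁ hadd₂ hcompat hjq y y' := by
  induction y using TensorProduct.induction_on with
  | zero => rw [smul_zero, map_zero, AddMonoidHom.zero_apply, mul_zero]
  | tmul b' v =>
    rw [TensorProduct.smul_tmul', smul_eq_mul, weilPeriodForm_tmul_eq_mul,
      weilPeriodForm_tmul_eq_mul W 𝔅 j e hμ hadd₁ hadd₂ hcompat hjq b', mul_assoc]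
  | add x x' hx hx' => rw [smul_add, map_add, map_add, AddMonoidHom.add_apply, AddMonoidHom.add_apply, hx, hx', mul_add]

/-- ★ **`B`-linearity on the right: `E_B(y, b • y') = b · E_B(y, y')`.** [cite: Kato1993LNM1553, Ch. II §1.2.4] -/
theorem weilPeriodForm_smul_right (b : 𝔅.B) (y y' : 𝔅.B ⊗[ℚ_[p]] W.rationalTateModule p) :
    weilPeriodForm W 𝔅 j e hμ hadd₁ hadd₂ hcompat hjq y (b • y') = b * weilPeriodForm W 𝔅 j e hμ hadd₁ hadd₂ hcompat hjq y y' := by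
  induction y using TensorProduct.induction_on with
  | zero => rw [map_zero, AddMonoidHom.zero_apply, AddMonoidHom.zero_apply, mul_zero]
  | tmul b' v =>
    rw [weilPeriodForm_tmul_eq_mul, weilPeriodForm_tmul_eq_mul W 𝔅 j e hμ hadd₁ hadd₂ hcompat hjq b' v y']
    have h1 := addMonoidHom_rational_ext' W
      (f := (AddMonoidHom.eval (b • y')).comp ((weilPeriodForm W 𝔅 j e hμ hadd₁ hadd₂ hcompat hjq).comp
        (TensorProduct.mk ℚ_[p] 𝔅.B (W.rationalTateModule p) 1).toAddMonoidHom))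
      (g := (AddMonoidHom.mulLeft b).comp ((AddMonoidHom.eval y').comp
        ((weilPeriodForm W 𝔅 j e hμ hadd₁ hadd₂ hcompat hjq).comp
          (TensorProduct.mk ℚ_[p] 𝔅.B (W.rationalTateModule p) 1).toAddMonoidHom)))
      fun c S => by
        change weilPeriodForm W 𝔅 j e hμ hadd₁ hadd₂ hcompat hjq ((1 : 𝔅.B) ⊗ₜ[ℚ_[p]] (c ⊗ₜ[ℤ_[p]] S)) (b • y') =
          b * weilPeriodForm W 𝔅 j e hμ hadd₁ hadd₂ hcompat hjq ((1 : 𝔅.B) ⊗ₜ[ℚ_[p]] (c ⊗ₜ[ℤ_[p]] S)) y'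
        rw [weilPeriodForm_tmul, weilPeriodForm_tmul, weilPeriodPairing_smul_right']
        ring
    have hv : weilPeriodForm W 𝔅 j e hμ hadd₁ hadd₂ hcompat hjq ((1 : 𝔅.B) ⊗ₜ[ℚ_[p]] v) (b • y') =
        b * weilPeriodForm W 𝔅 j e hμ hadd₁ hadd₂ hcompat hjq ((1 : 𝔅.B) ⊗ₜ[ℚ_[p]] v) y' := DFunLike.congr_fun h1 v
    rw [hv]
    ring
  | add x x' hx hx' => rw [map_add, AddMonoidHom.add_apply, AddMonoidHom.add_apply, hx, hx', mul_add]

omit [ValuativeRel F] [TopologicalSpace F] [IsNonarchimedeanLocalField F] [CharZero F] [Fact (¬ IsUnit (p : integerC F))]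
  [IsAdicComplete (Ideal.span {(p : integerC F)}) (integerC F)] in
/-- `σ` fixes the `ℚ_p`-scalars of `B`. [folklore] -/
private theorem smul_algebraMap_padic' (σ : absoluteGaloisGroup F) (c : ℚ_[p]) :
    σ • algebraMap ℚ_[p] 𝔅.B c = algebraMap ℚ_[p] 𝔅.B c := by
  rw [Algebra.algebraMap_eq_smul_one, smul_comm, smul_one]

variable (hj : ∀ (σ : absoluteGaloisGroup F) (b : BDeRhamPlus (integerC F) p), j (galBdRPlus σ b) = σ • j b) [W.IsElliptic]

include hj hgal in
/-- ★★ **Equivariance of `E_B`: `σ • E_B(y, y') = E_B(σ y, σ y')`** for the diagonal action `tensorRep` on `B ⊗ V_pW` (from the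
equivariance of `⟨·,·⟩~`, `smul_weilPeriodPairing`). [cite: Kato1993LNM1553, Ch. II §1.2.4 and proof of Lemma 1.4.3]
[cite: FontaineAsterisque223III, Exp. III §1.5] -/
theorem smul_weilPeriodForm (σ : absoluteGaloisGroup F) (y y' : 𝔅.B ⊗[ℚ_[p]] W.rationalTateModule p) :
    σ • weilPeriodForm W 𝔅 j e hμ hadd₁ hadd₂ hcompat hjq y y' =
      weilPeriodForm W 𝔅 j e hμ hadd₁ hadd₂ hcompat hjq (𝔅.tensorRep (restrictedRationalTateRep W F p) σ y)
        (𝔅.tensorRep (restrictedRationalTateRep W F p) σ y') := by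
  have h1 := addMonoidHom_rational_ext' W
    (f := (DistribSMul.toAddMonoidHom 𝔅.B σ).comp ((AddMonoidHom.eval y').comp
      ((weilPeriodForm W 𝔅 j e hμ hadd₁ hadd₂ hcompat hjq).comp (TensorProduct.mk ℚ_[p] 𝔅.B (W.rationalTateModule p) 1).toAddMonoidHom)))
    (g := ((AddMonoidHom.eval (𝔅.tensorRep (restrictedRationalTateRep W F p) σ y')).comp
        ((weilPeriodForm W 𝔅 j e hμ hadd₁ hadd₂ hcompat hjq).comp
          (TensorProduct.mk ℚ_[p] 𝔅.B (W.rationalTateModule p) 1).toAddMonoidHom)).comp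
      (restrictedRationalTateRep W F p σ).toAddMonoidHom)
    fun c S => by
      change σ • weilPeriodForm W 𝔅 j e hμ hadd₁ hadd₂ hcompat hjq ((1 : 𝔅.B) ⊗ₜ[ℚ_[p]] (c ⊗ₜ[ℤ_[p]] S)) y' =
        weilPeriodForm W 𝔅 j e hμ hadd₁ hadd₂ hcompat hjq ((1 : 𝔅.B) ⊗ₜ[ℚ_[p]] restrictedRationalTateRep W F p σ (c ⊗ₜ[ℤ_[p]] S))
          (𝔅.tensorRep (restrictedRationalTateRep W F p) σ y')
      have hV : restrictedRationalTateRep W F p σ (c ⊗ₜ[ℤ_[p]] S : W.rationalTateModule p) =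
          (c ⊗ₜ[ℤ_[p]] (restrictedTateRep W F p σ S) : W.rationalTateModule p) := by
        rw [restrictedTateRep_apply_apply]; rfl
      rw [hV, weilPeriodForm_tmul, weilPeriodForm_tmul, one_mul, one_mul, smul_mul', smul_algebraMap_padic',
        smul_weilPeriodPairing W 𝔅 j e hμ hadd₁ hadd₂ hgal hcompat hjq hj]
  induction y using TensorProduct.induction_on with
  | zero => simp only [map_zero, AddMonoidHom.zero_apply, smul_zero]
  | tmul b v =>
    rw [PeriodRingData.tensorRep_apply_tmul, weilPeriodForm_tmul_eq_mul, smul_mul',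
      weilPeriodForm_tmul_eq_mul W 𝔅 j e hμ hadd₁ hadd₂ hcompat hjq (σ • b)]
    exact congrArg ((σ • b) * ·) (DFunLike.congr_fun h1 v)
  | add x x' hx hx' => rw [map_add, AddMonoidHom.add_apply, smul_add, hx, hx', map_add, map_add, AddMonoidHom.add_apply]

end Literature.NumberTheory.PAdicHodge

end
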